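import Summits.AnomalousDissipation.AnomalousDissipation.Theorems.MomentParityLevelNMeasure
import Literature.Analysis.FluidPDE.StatisticalSolutionEnergyEq

/-!
# Route MomentParity · crux `GalerkinEnsembleRealization` — line `Sketch`, stub `stub_levelDissFloor`

The κ-resolution clause of the crux `GalerkinEnsembleRealization`
(stmt-AnomalousDissipation-11466) at one level `N`, turned into a floor for the mean resolved
enstrophy. The level-`N` ensemble is a probability measure `μ` on `H = Torus.energySpace (Fin 3)`
carried by fields band-limited to `freqBall N` (`û(k) = 0` off `(freqBall N).erase 0`, a.e.),
with dissipation floor `ε ≤ ν ∫ ‖∇u‖² dμ` (`ensembleDissipation`) and enstrophy resolved at the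
cutoff `κ n` up to `1/(n+1)`: `∫⁻ ‖∇u‖² dμ ≤ ∫⁻ ‖∇P_{κ n} u‖² dμ + 1/(n+1)`. Then
`ε − ν/(n+1) ≤ ν ∫ 4π² ∑_{|k| ≤ κ n} |k|² ‖û(k)‖² dμ`, the right-hand side written in the
coefficients `coeffExt (freqBall N) (û|_{freqBall N})` of the level-`N` Galerkin phase space
(the form produced on the trajectory space by Fubini and invariance). The mean enstrophy and the
enstrophy of a truncation as spectral sums: Foias–Manley–Rosa–Temam 2001, Ch. IV (1.28)–(1.29).
-/

noncomputable section

-- every `Summit.AnomalousDissipation.AnomalousDissipation.…` name repeats the summit = sub-problem segment (D-0017 layout)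
set_option linter.dupNamespace false

open MeasureTheory Set Filter Topology Function Metric UnitAddTorus
open scoped BigOperators ENNReal InnerProductSpace RealInnerProductSpace

namespace Summit.AnomalousDissipation.AnomalousDissipation.Theorems.MomentParity

open Literature.Analysis.FunctionSpaces Literature.Analysis.FunctionSpaces.Torus
open Literature.Analysis.FluidPDE Literature.Analysis.FluidPDE.Torus

variable {ν : ℝ}

/-- The resolved enstrophy at cutoff `K` of a field `u ∈ H` as the finite spectral sum in
`ℝ≥0∞`: `‖∇P_K u‖² = 4π² ∑_{|k| ≤ K} |k|² ‖û(k)‖²`. -/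
private theorem eGradNormSq_fourierTruncate_coe_eq_sum (K : ℕ) (u : Torus.energySpace (Fin 3)) :
    eGradNormSq (fourierTruncate K (u.1 : UnitAddTorus (Fin 3) → EuclideanSpace ℝ (Fin 3))) =
      ENNReal.ofReal (4 * Real.pi ^ 2) * ∑ k ∈ freqBall K, ENNReal.ofReal (freqNormSq k) *
        ‖mFourierCoeff (EuclideanSpace.complexify ∘
          (u.1 : UnitAddTorus (Fin 3) → EuclideanSpace ℝ (Fin 3))) k‖ₑ ^ 2 :=
  eGradNormSq_fourierTruncate_eq_sum ((Lp.memLp u.1).integrable one_le_two) K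

/-- The resolved enstrophy `u ↦ ‖∇P_K u‖²` is measurable on `H` (a finite sum of continuous
functions of finitely many Fourier coefficients). -/
private theorem measurable_eGradNormSq_fourierTruncate_coe (K : ℕ) :
    Measurable fun u : Torus.energySpace (Fin 3) =>
      eGradNormSq (fourierTruncate K (u.1 : UnitAddTorus (Fin 3) → EuclideanSpace ℝ (Fin 3))) := by
  simp_rw [eGradNormSq_fourierTruncate_coe_eq_sum]
  refine Measurable.const_mul (Finset.measurable_sum _ fun k _ => Measurable.const_mul ?_ _) _
  exact ((continuous_mFourierCoeff_complexify_coe k).comp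
    continuous_subtype_val).measurable.enorm.pow_const 2

/-- The resolved enstrophy at a finite cutoff is finite. -/
private theorem eGradNormSq_fourierTruncate_coe_lt_top (K : ℕ) (u : Torus.energySpace (Fin 3)) :
    eGradNormSq (fourierTruncate K (u.1 : UnitAddTorus (Fin 3) → EuclideanSpace ℝ (Fin 3))) < ∞ := by
  rw [eGradNormSq_fourierTruncate_coe_eq_sum]
  exact ENNReal.mul_lt_top ENNReal.ofReal_lt_top (ENNReal.sum_lt_top.2 fun k _ =>
    ENNReal.mul_lt_top ENNReal.ofReal_lt_top (ENNReal.pow_lt_top enorm_lt_top))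

/-- The resolved enstrophy in real form: `(‖∇P_K u‖²).toReal = 4π² ∑_{|k| ≤ K} |k|² ‖û(k)‖²`. -/
private theorem toReal_eGradNormSq_fourierTruncate_coe (K : ℕ) (u : Torus.energySpace (Fin 3)) :
    (eGradNormSq (fourierTruncate K
        (u.1 : UnitAddTorus (Fin 3) → EuclideanSpace ℝ (Fin 3)))).toReal =
      4 * Real.pi ^ 2 * ∑ k ∈ freqBall K, freqNormSq k *
        ‖mFourierCoeff (EuclideanSpace.complexify ∘
          (u.1 : UnitAddTorus (Fin 3) → EuclideanSpace ℝ (Fin 3))) k‖ ^ 2 := by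
  rw [eGradNormSq_fourierTruncate_coe_eq_sum, ENNReal.toReal_mul,
    ENNReal.toReal_ofReal (by positivity),
    ENNReal.toReal_sum fun k _ =>
      ENNReal.mul_ne_top ENNReal.ofReal_ne_top (ENNReal.pow_ne_top enorm_ne_top)]
  refine congrArg _ (Finset.sum_congr rfl fun k _ => ?_)
  rw [ENNReal.toReal_mul, ENNReal.toReal_ofReal (freqNormSq_nonneg k), ENNReal.toReal_pow,
    toReal_enorm]

/-- On a band-limited field the level-`N` coefficients reproduce every Fourier coefficient:
`coeffExt (freqBall N) (v̂|_{freqBall N}) k = v̂(k)` for all `k`, if `v̂` vanishes off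
`(freqBall N).erase 0`. -/
private theorem coeffExt_fourierRestrict_eq_of_vanish {N : ℕ}
    {v : UnitAddTorus (Fin 3) → EuclideanSpace ℝ (Fin 3)}
    (hv : ∀ k ∉ (freqBall N).erase (0 : Fin 3 → ℤ), mFourierCoeff (EuclideanSpace.complexify ∘ v) k = 0)
    (k : Fin 3 → ℤ) :
    coeffExt (freqBall N) (fourierRestrict (freqBall N) v) k =
      mFourierCoeff (EuclideanSpace.complexify ∘ v) k := by
  by_cases hk : k ∈ freqBall N
  · rw [coeffExt_of_mem _ hk, fourierRestrict_apply]
  · rw [coeffExt_of_not_mem _ hk, hv k fun h => hk (Finset.mem_of_mem_erase h)]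

/-- **Stub (κ-resolution clause as a floor for the mean resolved enstrophy).** For the level-`N`
ensemble `μ` (band-limited to `freqBall N`, dissipation `≥ ε`, enstrophy resolved at the cutoff
`κ n` up to `1/(n+1)`): `ε − ν/(n+1) ≤ ν ∫ 4π² ∑_{|k| ≤ κ n} |k|² ‖(û|_{freqBall N})‾(k)‖² dμ`.
A.e. the integrand is `ν (‖∇P_{κ n} u‖²).toReal` (band limitation), whose mean is
`ν (∫⁻ ‖∇P_{κ n} u‖² dμ).toReal`; if this lower integral is infinite so is the mean enstrophy
(`‖∇P_K u‖ ≤ ‖∇u‖`), whence `ε ≤ 0`; otherwise `toReal` is monotone and additive along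
`∫⁻ ‖∇u‖² ≤ ∫⁻ ‖∇P_{κ n} u‖² + 1/(n+1)`. -/
theorem stub_levelDissFloor (hν : 0 < ν) {N : ℕ} {R : ℝ} {κ : ℕ → ℕ} {ε : ℝ}
    {μ : Measure (Torus.energySpace (Fin 3))} [IsProbabilityMeasure μ]
    (h1 : ∀ᵐ u ∂μ, ∀ k ∉ (freqBall N).erase (0 : Fin 3 → ℤ),
      mFourierCoeff (EuclideanSpace.complexify ∘ (u.1 : UnitAddTorus (Fin 3) → EuclideanSpace ℝ (Fin 3))) k = 0)
    (h2 : ∀ᵐ u ∂μ, ‖u‖ ≤ R)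
    (h3 : ∀ n : ℕ, ∫⁻ u, eGradNormSq (u.1 : UnitAddTorus (Fin 3) → EuclideanSpace ℝ (Fin 3)) ∂μ ≤
      (∫⁻ u, eGradNormSq (fourierTruncate (κ n)
        (u.1 : UnitAddTorus (Fin 3) → EuclideanSpace ℝ (Fin 3))) ∂μ) + ((n : ℝ≥0∞) + 1)⁻¹)
    (hε : ε ≤ ensembleDissipation ν μ) (n : ℕ) :
    ε - ν * ((n : ℝ) + 1)⁻¹ ≤
      ∫ u, ν * (4 * Real.pi ^ 2 * ∑ k ∈ freqBall (κ n), freqNormSq k *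
        ‖coeffExt (freqBall N) (fourierRestrict (freqBall N)
          (u.1 : UnitAddTorus (Fin 3) → EuclideanSpace ℝ (Fin 3))) k‖ ^ 2) ∂μ := by
  -- the ball bound `h2` is part of the registered signature but not needed here
  have _h2 := h2
  clear _h2 h2
  -- a.e. the integrand is `ν (‖∇P_{κ n} u‖²).toReal`
  have hae : (fun u : Torus.energySpace (Fin 3) => ν * (4 * Real.pi ^ 2 *
      ∑ k ∈ freqBall (κ n), freqNormSq k * ‖coeffExt (freqBall N) (fourierRestrict (freqBall N)
        (u.1 : UnitAddTorus (Fin 3) → EuclideanSpace ℝ (Fin 3))) k‖ ^ 2)) =ᵐ[μ]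
      fun u => ν * (eGradNormSq (fourierTruncate (κ n)
        (u.1 : UnitAddTorus (Fin 3) → EuclideanSpace ℝ (Fin 3)))).toReal := by
    filter_upwards [h1] with u hu
    rw [toReal_eGradNormSq_fourierTruncate_coe]
    simp only [coeffExt_fourierRestrict_eq_of_vanish hu]
  rw [integral_congr_ae hae, integral_const_mul,
    integral_toReal (measurable_eGradNormSq_fourierTruncate_coe (κ n)).aemeasurable
      (ae_of_all _ fun u => eGradNormSq_fourierTruncate_coe_lt_top (κ n) u)]
  -- the dissipation floor, the κ-resolution clause and `‖∇P_K u‖ ≤ ‖∇u‖`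
  have hε' : ε ≤ ν * (∫⁻ u, eGradNormSq
      (u.1 : UnitAddTorus (Fin 3) → EuclideanSpace ℝ (Fin 3)) ∂μ).toReal := hε
  have h3n := h3 n
  have hFG : ∫⁻ u, eGradNormSq (fourierTruncate (κ n)
      (u.1 : UnitAddTorus (Fin 3) → EuclideanSpace ℝ (Fin 3))) ∂μ ≤
      ∫⁻ u, eGradNormSq (u.1 : UnitAddTorus (Fin 3) → EuclideanSpace ℝ (Fin 3)) ∂μ :=
    lintegral_mono fun u =>
      eGradNormSq_fourierTruncate_le ((Lp.memLp u.1).integrable one_le_two) (κ n)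
  have hn : (0 : ℝ) < ((n : ℝ) + 1)⁻¹ := by positivity
  have hn' : ((n : ℝ≥0∞) + 1)⁻¹ ≠ ∞ :=
    ENNReal.inv_ne_top.2 (zero_lt_one.trans_le le_add_self).ne'
  by_cases hFtop : ∫⁻ u, eGradNormSq (fourierTruncate (κ n)
      (u.1 : UnitAddTorus (Fin 3) → EuclideanSpace ℝ (Fin 3))) ∂μ = ∞
  · -- infinite mean resolved enstrophy: the mean enstrophy is infinite and `ε ≤ 0`
    have hGtop : ∫⁻ u, eGradNormSq (u.1 : UnitAddTorus (Fin 3) → EuclideanSpace ℝ (Fin 3)) ∂μ = ∞ :=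
      eq_top_iff.2 (hFtop.symm.le.trans hFG)
    rw [hGtop, ENNReal.toReal_top, mul_zero] at hε'
    rw [hFtop, ENNReal.toReal_top, mul_zero]
    nlinarith [mul_pos hν hn]
  · -- finite: `toReal` is monotone and additive
    have hle : (∫⁻ u, eGradNormSq (u.1 : UnitAddTorus (Fin 3) → EuclideanSpace ℝ (Fin 3)) ∂μ).toReal ≤
        (∫⁻ u, eGradNormSq (fourierTruncate (κ n)
          (u.1 : UnitAddTorus (Fin 3) → EuclideanSpace ℝ (Fin 3))) ∂μ).toReal + ((n : ℝ) + 1)⁻¹ := by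
      have h := ENNReal.toReal_mono (ENNReal.add_ne_top.2 ⟨hFtop, hn'⟩) h3n
      rwa [ENNReal.toReal_add hFtop hn', ENNReal.toReal_inv,
        ENNReal.toReal_add (ENNReal.natCast_ne_top n) ENNReal.one_ne_top, ENNReal.toReal_natCast,
        ENNReal.toReal_one] at h
    have h := mul_le_mul_of_nonneg_left hle hν.le
    rw [mul_add] at h
    linarith

end Summit.AnomalousDissipation.AnomalousDissipation.Theorems.MomentParity
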